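import Literature.AlgebraicGeometry.HodgeTheory.BlochSemiregularSpreadOfSubscheme
import Literature.AlgebraicGeometry.HodgeTheory.ComplexOrientationCycleClassFacts
import Literature.AlgebraicGeometry.HodgeTheory.SupportedClassesGysinSpan
import Literature.AlgebraicGeometry.HodgeTheory.IsoTransport
import Literature.AlgebraicGeometry.HodgeTheory.FibreRestrictionsLocallyConstantRank
import Literature.AlgebraicGeometry.HodgeTheory.DirectImageBaseChangeSections
import Literature.AlgebraicGeometry.HodgeTheory.GysinFormalismHodgeOfGysin
import Literature.AlgebraicGeometry.HodgeTheory.RationalClassesIndependent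
import Literature.AlgebraicGeometry.HodgeTheory.CanonicalTrace
import Literature.AlgebraicGeometry.Motives.CurveNet
import HarnessLib

/-!
# `BlochSemiregularSpread n p` follows from `BlochSemiregularSpreadOfSubscheme n p`
# (Bloch 1972, Thm. (7.4); Buchweitz–Flenner 2003, Thm. 5.2) — proved

Family `hodge`, layer `Literature/AlgebraicGeometry/HodgeTheory`. THEOREMS ONLY (no definition, no new
named fact; D-0026). The tree carries two renderings of Bloch's class-level semiregularity theorem
for a local complete intersection seed, vendored for the cell `pub-hsemireg` (HodgeConjecture
venture) on 2026-08-22: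

* `BlochSemiregularSpread n p` (`BlochSemiregularSpread.lean`): `Z` INTEGRAL, class hypothesis
  "`x` supported on `Z`" (`x ∈ classesSupportedOn X₀ Z (2p)`), no `IsSmoothProjective n X₀` binder
  (only `e : X₀ ≅ 𝒳_{s₀}`);
* `BlochSemiregularSpreadOfSubscheme n p` (`BlochSemiregularSpreadOfSubscheme.lean`): `Z` an
  ARBITRARY local complete intersection closed subscheme, class hypothesis `x = [Z]`
  (`subschemeClass hX₀ hdp ρ i hi`, Fulton's cycle of the subscheme under the tree's cycle class).

This file PROVES that the first is a COROLLARY of the second — `blochSemiregularSpread_of_subscheme` —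
so that every consumer of the cell's transfer chain rests on ONE cited Bloch/Buchweitz–Flenner fact.
The proof is the dictionary step (D3) of the module docstring of `BlochSemiregularSpread.lean`, now
carried out on the tree's real carriers with tree THEOREMS only:

1. `X₀ ≅ 𝒳_{s₀}` is smooth projective of dimension `n` (`IsSmoothProjective.of_iso`), `Z` is locally
   Noetherian, and `dim Z + codim Z = n` at the generic point `η` of `Z`
   (`exists_height_eq_coheight_eq`); a resolution family `ρ` in dimension `d = dim Z` exists
   (`nonempty_resolutionFamily`, Hironaka), and its member `τ : V ⟶ X₀` at `i(η)` maps ONTO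
   `i(Z) = closure {i(η)}`.
2. PURITY (Deligne, Hodge III, Cor. 8.2.8, the tree's theorem
   `Deligne1974_ker_restrictCompl_eq_iSup_range_complexGysin_holds`): a class `x ∈ H^{2p}(X₀(ℂ); ℂ)`
   dying off `i(Z) = τ(V)` lies in `Σₐ τ_* Hᵃ(V(ℂ); ℂ)`, `a + 2n = 2p + 2d`; if `codim Z > p` no degree
   `a` qualifies and `x = 0`; if `codim Z = p` then `a = 0`, `H⁰(V(ℂ); ℂ) = ℂ·1`
   (`exists_eq_smul_one_of_isSmoothProjective`) and `x = λ·τ_* 1 = λ·[Z]`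
   (`subschemeClass_of_isIntegral`).
3. If `x = 0`: the flat section `s ↦ W|_{𝒳_s}` vanishes at `s₀`, hence on an open neighbourhood
   (Ehresmann: `isCohomologicallyLocallyTrivialOn_univ_of_isSmoothProjectiveFamily_of_smooth` and
   `isOpen_setOf_map_fiberι_eq_zero`), where `0` is algebraic.
4. If `x ≠ 0`: `x = e^*(W|_{𝒳_{s₀}})` is rational (`isRationalClass_map_iff_of_iso`), `[Z] = τ_* 1` is
   rational (`isRationalClass_complexGysin_complexOrientationFamily`) and non-zero, so `λ ∈ ℚ`
   (`ℚ`-form of `H^{2p}`: `linearIndependent_iff_of_isRationalClass`); apply the subscheme fact to the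
   horizontal section `λ⁻¹·W`, whose value at `s₀` is `[Z]`, and multiply back by `λ`.

Net effect for the trust base: consumers of `BlochSemiregularSpread` may instead assume
`BlochSemiregularSpreadOfSubscheme` (one printed theorem, one named fact).

## References

* [Bloch1972Semiregularity] S. Bloch, Semi-regularity and de Rham cohomology, Invent. Math. 17 (1972)
  51–66: §0, Thm. (7.1), Thm. (7.4).
* [BuchweitzFlenner2003] R.-O. Buchweitz, H. Flenner, Compositio Math. 137 (2003): Thm. 5.2; proof of
  Cor. 4.12 (`[Z] = ch_p(𝒪_Z)`).
* [DeligneHodgeIII1974] P. Deligne, Théorie de Hodge III, Cor. 8.2.8 (purity).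
* [Fulton1998] W. Fulton, Intersection Theory: §1.5, §19.1 (Lemma 19.1.1: `H^{2p}_Z = ℂ·cl(Z)`).
* [VoisinHodgeI2002] C. Voisin, Hodge Theory and Complex Algebraic Geometry I, §7.1.1 (rational
  structure), §9.2.1 (Ehresmann, local systems), §11.1.4 (`[Z] = τ_* 1`).
-/

noncomputable section

open CategoryTheory CategoryTheory.Limits AlgebraicGeometry Opposite TopologicalSpace Order

namespace Literature.AlgebraicGeometry.HodgeTheory

open Literature.AlgebraicGeometry.Motives Literature.AlgebraicTopology.SingularHomology

section RationalLine

/-- **A complex multiple of a non-zero rational class is rational only for a rational multiplier**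
(`H^k(Y; ℚ) ⊗ ℂ → H^k(Y; ℂ)` is injective: the rational pair `(c • v, v)` is `ℂ`-dependent, hence
satisfies a non-trivial RATIONAL relation, `linearIndependent_iff_of_isRationalClass`).
[cite: VoisinHodgeI2002, §7.1.1] [cite: HatcherAT2002, §3.1 Thm. 3.2 and p. 198] -/
theorem IsRationalClass.exists_rat_eq_of_smul {Y : Type} [TopologicalSpace Y] {k : ℕ}
    {v : singularCohomology ℂ ℂ Y k} (hv : IsRationalClass v) (hv0 : v ≠ 0) {c : ℂ}
    (hcv : IsRationalClass (c • v)) : ∃ q : ℚ, c = (q : ℂ) := by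
  classical
  let b : Fin 2 → singularCohomology ℂ ℂ Y k := ![c • v, v]
  have hb : ∀ j, IsRationalClass (b j) := by
    intro j
    fin_cases j
    · exact hcv
    · exact hv
  have hdep : ¬ LinearIndependent ℂ b := by
    rw [Fintype.not_linearIndependent_iff]
    refine ⟨![1, -c], ?_, 0, by simp⟩
    simp [b, Fin.sum_univ_two]
  rw [linearIndependent_iff_of_isRationalClass hb] at hdep
  push Not at hdep
  obtain ⟨q, hq, hq0⟩ := hdep
  simp only [b, Fin.sum_univ_two, Matrix.cons_val_zero, Matrix.cons_val_one,
    smul_smul, ← add_smul] at hq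
  have hcoef : ((q 0 : ℚ) : ℂ) * c + ((q 1 : ℚ) : ℂ) = 0 := by
    by_contra hne
    exact hv0 ((smul_eq_zero.1 hq).resolve_left hne)
  have hq0' : q 0 ≠ 0 := by
    intro h0
    apply hq0
    have h1 : q 1 = 0 := by
      have : ((q 1 : ℚ) : ℂ) = 0 := by simpa [h0] using hcoef
      exact_mod_cast this
    funext j
    fin_cases j
    · exact h0
    · exact h1
  refine ⟨-(q 1) / q 0, ?_⟩
  have hq0C : ((q 0 : ℚ) : ℂ) ≠ 0 := by exact_mod_cast hq0'
  rw [Rat.cast_div, Rat.cast_neg, eq_div_iff hq0C]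
  linear_combination hcoef

end RationalLine

section OfSubscheme

local notation3 (prettyPrint := false) "Res[" f ", " s ", " k ", " A "]" =>
  complexBetti.map (Motives.fiberι f s) k A

/-- **The integral form of Bloch's theorem is a corollary of the subscheme form**:
`BlochSemiregularSpreadOfSubscheme n p` (Bloch (7.4) / BF Thm. 5.2 for an arbitrary local complete
intersection subscheme, class `[Z]`) implies `BlochSemiregularSpread n p` (the same for `Z` integral,
class SUPPORTED on `Z`). Proof (module docstring): purity `x = λ·[Z]` or `x = 0` (Deligne, Hodge III,
Cor. 8.2.8 with `H⁰(V) = ℂ` for the resolution `V` of `Z`); `x = 0` spreads as `0` by Ehresmann;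
otherwise `λ ∈ ℚ` (rational structure) and the subscheme fact applies to `λ⁻¹·W`.
[cite: Bloch1972Semiregularity, Thm. (7.4) with §0 and Thm. (7.1)]
[cite: BuchweitzFlenner2003, Thm. 5.2 and proof of Cor. 4.12]
[cite: DeligneHodgeIII1974, Cor. 8.2.8] [cite: Fulton1998, Lemma 19.1.1 and §19.1]
[cite: VoisinHodgeI2002, §7.1.1, §9.2.1 and §11.1.4] -/
theorem blochSemiregularSpread_of_subscheme {n p : ℕ} (h : BlochSemiregularSpreadOfSubscheme n p) :
    BlochSemiregularSpread n p := by
  intro X₀ Z i x 𝒳 S f s₀ e W hi hreg hZ hcodim hsr hsupp hf h𝒳 hS hSm hW hx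
  classical
  -- (1) `X₀` is smooth projective of dimension `n`; instances
  have hX₀ : IsSmoothProjective n X₀ := IsSmoothProjective.of_iso e.symm (hf.isSmoothProjective s₀)
  haveI : IsLocallyNoetherian X₀.left := Motives.IsSmoothProjective.isLocallyNoetherian_holds hX₀
  haveI := hi
  haveI : IsLocallyNoetherian Z := LocallyOfFiniteType.isLocallyNoetherian i
  haveI := hZ
  haveI := hSm
  -- (3) the branch `x = 0`: the flat section vanishes near `s₀` (Ehresmann)
  have zero_branch : x = 0 → ∃ U : Set (ComplexPoints S), IsOpen U ∧ s₀ ∈ U ∧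
      ∀ t ∈ U, Res[f, t, 2 * p, W] ∈ algebraicClasses (fiberOver f t) p := by
    intro hx0
    have hW0 : Res[f, s₀, 2 * p, W] = 0 := by
      have h1 := congrArg (complexBetti.map e.inv (2 * p)) hx
      rw [e.complexBetti_map_inv_map_hom, hx0, map_zero] at h1
      exact h1
    have hE := isCohomologicallyLocallyTrivialOn_univ_of_isSmoothProjectiveFamily_of_smooth f hf
    refine ⟨{s | s ∈ Set.univ ∧ Res[f, s, 2 * p, W] = 0}, isOpen_setOf_map_fiberι_eq_zero hE W,
      ⟨Set.mem_univ _, hW0⟩, fun t ht ↦ ?_⟩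
    rw [ht.2]
    exact Submodule.zero_mem _
  -- (1) dimension bookkeeping at the generic point of `Z`
  set z₀ : X₀.left := i.base (genericPoint Z) with hz₀def
  have hclos : closure ({z₀} : Set X₀.left) = Set.range i.base := by
    have h' := (genericPoint_spec Z).image i.continuous
    rw [Set.image_univ, i.isClosedEmbedding.isClosed_range.closure_eq] at h'
    exact h'
  obtain ⟨d, c, hd, hc, hdc⟩ := exists_height_eq_coheight_eq hX₀ z₀
  have hpc : p ≤ c := by
    have h' := hcodim z₀ ⟨genericPoint Z, rfl⟩
    rw [hc] at h'
    exact_mod_cast h'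
  obtain ⟨ρ⟩ := nonempty_resolutionFamily hX₀ d
  -- the resolution `τ : V ⟶ X₀` of `i(Z) = closure {z₀}`
  set zd : {z : X₀.left // Order.height z = (d : ℕ∞)} := ⟨z₀, hd⟩ with hzddef
  have hV : IsSmoothProjective d (ρ.V zd) := ρ.smooth zd
  have hτ : Set.range (ρ.hom zd).left.base = Set.range i.base := by
    apply le_antisymm
    · rintro _ ⟨v, rfl⟩
      rw [← hclos]
      exact ρ.base_mem_closure zd v
    · rw [← hclos]
      have hcl : IsClosed (⋃ _ : PUnit, Set.range (ρ.hom zd).left.base) :=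
        isClosed_iUnion_range_of_isSmoothProjective hX₀ (fun _ : PUnit ↦ hV) fun _ ↦ ρ.hom zd
      rw [Set.iUnion_const] at hcl
      exact closure_minimal (Set.singleton_subset_iff.2 ⟨ρ.gen zd, ρ.base_gen zd⟩) hcl
  -- (2) purity: `x ∈ Σₐ τ_* Hᵃ(V)`
  have hU : (⋃ _ : PUnit, Set.range (ρ.hom zd).left.base) = Set.range i.base := by
    rw [Set.iUnion_const, hτ]
  have hx0 : complexBetti.restrictCompl X₀ (⋃ _ : PUnit, Set.range (ρ.hom zd).left.base)
      (2 * p) x = 0 := by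
    rw [hU]
    exact LinearMap.mem_ker.1 hsupp
  have hmem := Deligne1974_ker_restrictCompl_eq_iSup_range_complexGysin_holds.mem_iSup_range
    complexOrientationFamily complexOrientationFamily.hasPoincareDuality hX₀
    (ι := PUnit) (m := fun _ ↦ d) (Y := fun _ ↦ ρ.V zd) (fun _ ↦ hV) (fun _ ↦ ρ.hom zd) hx0
  by_cases hdp : d + p = n
  swap
  · -- `codim Z > p`: no Gysin degree qualifies, `x = 0`
    apply zero_branch
    have hbot : (⨆ (j : PUnit) (a : ℕ) (hab : a + 2 * n = 2 * p + 2 * (fun _ : PUnit ↦ d) j),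
        LinearMap.range (complexGysin complexOrientationFamily ((fun _ : PUnit ↦ hV) j) hX₀
          ((fun _ : PUnit ↦ ρ.hom zd) j) hab)) = ⊥ := by
      refine iSup_eq_bot.2 fun j ↦ iSup_eq_bot.2 fun a ↦ iSup_eq_bot.2 fun hab ↦ ?_
      exfalso
      change a + 2 * n = 2 * p + 2 * d at hab
      omega
    rw [hbot] at hmem
    exact (Submodule.mem_bot ℂ).1 hmem
  -- `codim Z = p`: `x = λ · τ_* 1 = λ · [Z]`
  have hab0 : 0 + 2 * n = 2 * p + 2 * d := by omega
  have hle : (⨆ (j : PUnit) (a : ℕ) (hab : a + 2 * n = 2 * p + 2 * (fun _ : PUnit ↦ d) j),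
      LinearMap.range (complexGysin complexOrientationFamily ((fun _ : PUnit ↦ hV) j) hX₀
        ((fun _ : PUnit ↦ ρ.hom zd) j) hab)) ≤
      LinearMap.range (complexGysin complexOrientationFamily hV hX₀ (ρ.hom zd) hab0) := by
    refine iSup_le fun j ↦ iSup_le fun a ↦ iSup_le fun hab ↦ ?_
    obtain rfl : a = 0 := by
      change a + 2 * n = 2 * p + 2 * d at hab
      omega
    exact le_rfl
  have hxr : x ∈ LinearMap.range
      (complexGysin complexOrientationFamily hV hX₀ (ρ.hom zd) hab0) := hle hmem
  obtain ⟨y, hy⟩ := LinearMap.mem_range.1 hxr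
  obtain ⟨cc, rfl⟩ := exists_eq_smul_one_of_isSmoothProjective hV ℂ y
  have hcls : subschemeClass hX₀ hdp ρ i hi =
      complexGysin complexOrientationFamily hV hX₀ (ρ.hom zd) hab0
        (singularCohomology.one ℂ (Motives.ComplexPoints (ρ.V zd))) :=
    subschemeClass_of_isIntegral hX₀ hdp ρ i hi hd
  have hxcls : x = cc • subschemeClass hX₀ hdp ρ i hi := by
    rw [hcls, ← map_smul, hy]
  by_cases hx00 : x = 0
  · exact zero_branch hx00
  -- (4) `x ≠ 0`: `λ ∈ ℚ`, apply the subscheme fact to `λ⁻¹ · W`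
  have hxrat : IsRationalClass x := by
    rw [← hx]
    exact (isRationalClass_map_iff_of_iso e).2 (hW s₀).1
  have hZrat : IsRationalClass (subschemeClass hX₀ hdp ρ i hi) := by
    rw [hcls]
    exact isRationalClass_complexGysin_complexOrientationFamily hV hX₀ _ hab0 (isRationalClass_one _)
  have hZne : subschemeClass hX₀ hdp ρ i hi ≠ 0 := by
    intro h0
    exact hx00 (by rw [hxcls, h0, smul_zero])
  obtain ⟨q, hq⟩ := hZrat.exists_rat_eq_of_smul hZne (hxcls ▸ hxrat)
  have hq0 : q ≠ 0 := by
    rintro rfl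
    exact hx00 (by rw [hxcls, hq, Rat.cast_zero, zero_smul])
  have hqC : (q : ℂ) ≠ 0 := by exact_mod_cast hq0
  -- the horizontal section `q⁻¹ · W`
  set W' : complexBetti 𝒳 (2 * p) := ((q⁻¹ : ℚ) : ℂ) • W with hW'def
  have hres : ∀ s : ComplexPoints S, Res[f, s, 2 * p, W'] = ((q⁻¹ : ℚ) : ℂ) • Res[f, s, 2 * p, W] := by
    intro s
    rw [hW'def, map_smul]
  have hW' : ∀ s : ComplexPoints S, IsRationalClass (Res[f, s, 2 * p, W']) ∧
      IsOfHodgeType n (fiberOver f s) (2 * p) p p (Res[f, s, 2 * p, W']) := by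
    intro s
    rw [hres]
    exact ⟨(hW s).1.smul _, (hW s).2.smul _⟩
  have hx' : complexBetti.map e.hom (2 * p) (Res[f, s₀, 2 * p, W']) =
      subschemeClass hX₀ hdp ρ i hi := by
    rw [hres, map_smul, hx, hxcls, hq, smul_smul, Rat.cast_inv, inv_mul_cancel₀ hqC, one_smul]
  have hmemZ : subschemeCycle i hi ∈ cyclesOfDim X₀.left d := by
    rw [subschemeCycle_of_isIntegral i hi]
    exact primeCycle_mem_cyclesOfDim hd
  obtain ⟨U, hUo, hs₀U, hUA⟩ :=
    h X₀ Z i _ 𝒳 S f s₀ e W' hX₀ d hdp ρ hi hreg hcodim hsr hmemZ rfl hf h𝒳 hS hSm hW' hx'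
  refine ⟨U, hUo, hs₀U, fun t ht ↦ ?_⟩
  have h1 := Submodule.smul_mem _ (q : ℂ) (hUA t ht)
  rwa [hres, smul_smul, Rat.cast_inv, mul_inv_cancel₀ hqC, one_smul] at h1

end OfSubscheme

end Literature.AlgebraicGeometry.HodgeTheory

end
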